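import Summits.QuantumFields.YangMills.Theses.RevelationMartingale
import Summits.QuantumFields.YangMills.Theorems.RevelationMartingaleBondFiltration
import Summits.QuantumFields.YangMills.Theorems.RevelationMartingaleProxyQuadraticVariation
import HarnessLib

/-!
# Route RevelationMartingale — the GLOBAL centred sub-Gaussian MGF at scale `g_(K−j)` implies the deciding crux
# `SubGaussianRevelationL` (stmt-QuantumFields-23082): the trivial-filtration instance, BY KERNEL

Cell `ym3-torus` (YM ladder rung R3 = continuum SU(2) Yang–Mills on the three-torus — a RUNG, NOT the Clay problem),
width seat `ym-ust-19936-w3` gen 10; line «revelation_martingale» on the crux `HistoryTailL` (stmt-QuantumFields-19936).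

The route's thesis names the trivial filtration `(⊥, ⊤, ⊤, …)` with horizon `n = 1` as the instance of the `∃ ℱ`-typed
deciding crux `SubGaussianRevelationL` that «would need the GLOBAL sub-Gaussian MGF `E e^(s(f−Ef)) ≤ e^(s²Cv g²/2)` for
all real `s`».  This file is that sentence as a theorem: `subGaussianRevelationL_of_globalCentredMGF` — the GLOBAL CENTRED
sub-Gaussian exponential-moment bound of `f = dist1(Ū^j(∂p))` under `gibbsK` at scale `g_(K−j)² = γ·L^{−(K−j)}`, for every
real `s`, with the route's constants-before-the-family prefix, IMPLIES `Theses.RevelationMartingale.SubGaussianRevelationL`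
(filtration `ℱ 0 = ⊥`, `ℱ i = ⊤` for `i ≥ 1`; `n = 1`; the single proxy `σ 0 ≡ Cv·g²`, `σ i ≡ 0` for `i ≥ 1`; the window is
not even used).  Together with the sibling ✓`RevelationMartingaleWindowedQVOfSubGaussianRevelation.windowedMoments_of_
subGaussianRevelationL` (23082 ⇒ the WINDOWED centred sub-Gaussian MGF at the same scale, every real `l`) this SANDWICHES the
deciding crux by kernel between the global and the windowed centred-MGF currencies at scale `g_(K−j)`:
`GLOBAL centred MGF ⇒ SubGaussianRevelationL ⇒ WINDOWED centred MGF`.  Neither outer statement is claimed; nothing here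
proves 23082, a stub, `HistoryTailL` or a summit statement. [folklore]
-/

namespace Summit.QuantumFields.YangMills.Theorems.RevelationMartingaleProxyQV

open scoped BigOperators Classical MeasureTheory
open MeasureTheory Literature.MathematicalPhysics.QuantumFieldTheory.Balaban1983to89
  Literature.MathematicalPhysics.QuantumFieldTheory.Balaban1983to89.T3ContinuumYM3Torus

/-- The two-valued filtration `⊥, ⊤, ⊤, …` of a measurable space, as a `Filtration ℕ`. [folklore] -/
theorem exists_filtration_bot_then_top (Ω : Type*) [mΩ : MeasurableSpace Ω] :
    ∃ ℱ : MeasureTheory.Filtration ℕ mΩ, ℱ 0 = (⊥ : MeasurableSpace Ω) ∧ ∀ i, 1 ≤ i → ℱ i = mΩ := by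
  refine ⟨⟨fun i => if i = 0 then ⊥ else mΩ, ?_, ?_⟩, ?_, ?_⟩
  · intro i k hik
    by_cases hi : i = 0
    · simp only [hi, if_true]; exact bot_le
    · have hk : k ≠ 0 := by omega
      simp only [hi, hk, if_false]; exact le_rfl
  · intro i
    by_cases hi : i = 0
    · simp only [hi, if_true]; exact bot_le
    · simp only [hi, if_false]; exact le_rfl
  · show (if (0 : ℕ) = 0 then (⊥ : MeasurableSpace Ω) else mΩ) = ⊥
    simp
  · intro i hi
    have hi' : i ≠ 0 := by omega
    show (if i = 0 then (⊥ : MeasurableSpace Ω) else mΩ) = mΩ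
    simp [hi']

/-- **GLOBAL CENTRED SUB-GAUSSIAN MGF ⇒ THE DECIDING CRUX (trivial-filtration instance).**  If, with constants `γ₁, Cv`
fixed before the family, `∫ exp(s·(f − ∫ f dμ)) dμ ≤ exp(s²·Cv·γ·L^{−(K−j)}/2)` for EVERY real `s` (`f = dist1(Ū^j(∂p))`,
`μ = gibbsK F ℰp γ K`) at every `(F, γ ≤ γ₁, 1 ≤ j ≤ K, p)`, then `Theses.RevelationMartingale.SubGaussianRevelationL` holds —
witnessed by the filtration `⊥, ⊤, ⊤, …`, horizon `n = 1`, proxies `σ 0 ≡ Cv·γ·L^{−(K−j)}`, `σ i ≡ 0` (`i ≥ 1`): the one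
non-trivial row is the hypothesis (`μ[f|⊤] = f`, `μ[·|⊥] = ∫ ·`), all later increments vanish, and the proxy sum is the
budget itself (on and off the window).  The route thesis's «cheapest instance» sentence, by kernel. [folklore] -/
theorem subGaussianRevelationL_of_globalCentredMGF
    (h : ∀ (L : ℕ) (b₀ p₀ b₂ : ℝ), 0 < b₀ → 2 < p₀ → b₀ ≤ b₂ → ∃ (γ₁ Cv : ℝ), 0 < γ₁ ∧ γ₁ ≤ 1 ∧ 0 < Cv ∧
      ∀ (F : T3Family) (γ : ℝ), F.L = L → 0 < γ → γ ≤ γ₁ → ∀ (K j : ℕ), 1 ≤ j → j ≤ K → ∀ p : Plaq (F.P K) j,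
      ∀ s : ℝ, ∫ U, Real.exp (s * (GaugeGroup.dist1 (GaugeField.plaqHol
              (Averaging.iter (fun i => BlockAveraging.blockAvg (P := F.P K) (j := i) T3UnitLawDensityEML.ℰp) j U) p) -
            ∫ X, GaugeGroup.dist1 (GaugeField.plaqHol
              (Averaging.iter (fun i => BlockAveraging.blockAvg (P := F.P K) (j := i) T3UnitLawDensityEML.ℰp) j X) p) ∂(T3UnitScaleTilt.gibbsK F T3UnitLawDensityEML.ℰp γ K))) ∂(T3UnitScaleTilt.gibbsK F T3UnitLawDensityEML.ℰp γ K)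
          ≤ Real.exp (s ^ 2 * (Cv * (γ * ((F.L : ℝ)⁻¹) ^ (K - j))) / 2)) :
    Summit.QuantumFields.YangMills.Theses.RevelationMartingale.SubGaussianRevelationL := by
  intro L b₀ p₀ b₂ hb₀ hp₀ hb₂
  obtain ⟨γ₁, Cv, hγ₁, hγ₁1, hCv, hF⟩ := h L b₀ p₀ b₂ hb₀ hp₀ hb₂
  refine ⟨γ₁, Cv, hγ₁, hγ₁1, hCv, fun F γ hL hγ hγle K j hj hjK p => ?_⟩
  have hrow := hF F γ hL hγ hγle K j hj hjK p
  haveI := T3UnitScaleTilt.isProbabilityMeasure_gibbsK F T3UnitLawDensityEML.ℰp hγ.le K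
  obtain ⟨ℱ, h0, htop⟩ := exists_filtration_bot_then_top (GaugeField (F.P K) 0 (Matrix.specialUnitaryGroup (Fin 2) ℂ))
  -- the observable: measurable, bounded, integrable; its conditional expectations at `⊤` and `⊥`
  have hf_meas : StronglyMeasurable (fun U : GaugeField (F.P K) 0 (Matrix.specialUnitaryGroup (Fin 2) ℂ) => GaugeGroup.dist1 (GaugeField.plaqHol
              (Averaging.iter (fun i => BlockAveraging.blockAvg (P := F.P K) (j := i) T3UnitLawDensityEML.ℰp) j U) p)) := (measurable_dist1_iter_plaqHol F K j p).stronglyMeasurable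
  have hf_int : Integrable (fun U : GaugeField (F.P K) 0 (Matrix.specialUnitaryGroup (Fin 2) ℂ) => GaugeGroup.dist1 (GaugeField.plaqHol
              (Averaging.iter (fun i => BlockAveraging.blockAvg (P := F.P K) (j := i) T3UnitLawDensityEML.ℰp) j U) p)) (T3UnitScaleTilt.gibbsK F T3UnitLawDensityEML.ℰp γ K) := by
    refine Integrable.of_bound hf_meas.aestronglyMeasurable 2 (Filter.Eventually.of_forall fun U => ?_)
    rw [Real.norm_eq_abs]
    exact abs_dist1_iter_plaqHol_le_two F K j p U
  have hMtop : ∀ i, 1 ≤ i → MeasureTheory.condExp (ℱ i) (T3UnitScaleTilt.gibbsK F T3UnitLawDensityEML.ℰp γ K)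
      (fun U : GaugeField (F.P K) 0 (Matrix.specialUnitaryGroup (Fin 2) ℂ) => GaugeGroup.dist1 (GaugeField.plaqHol
              (Averaging.iter (fun i => BlockAveraging.blockAvg (P := F.P K) (j := i) T3UnitLawDensityEML.ℰp) j U) p)) = fun U => GaugeGroup.dist1 (GaugeField.plaqHol
              (Averaging.iter (fun i => BlockAveraging.blockAvg (P := F.P K) (j := i) T3UnitLawDensityEML.ℰp) j U) p) := by
    intro i hi
    have hfi : StronglyMeasurable[ℱ i] (fun U : GaugeField (F.P K) 0 (Matrix.specialUnitaryGroup (Fin 2) ℂ) => GaugeGroup.dist1 (GaugeField.plaqHol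
              (Averaging.iter (fun i => BlockAveraging.blockAvg (P := F.P K) (j := i) T3UnitLawDensityEML.ℰp) j U) p)) := by rw [htop i hi]; exact hf_meas
    exact condExp_of_stronglyMeasurable (ℱ.le i) hfi hf_int
  have hM0 : MeasureTheory.condExp (ℱ 0) (T3UnitScaleTilt.gibbsK F T3UnitLawDensityEML.ℰp γ K) (fun U : GaugeField (F.P K) 0 (Matrix.specialUnitaryGroup (Fin 2) ℂ) => GaugeGroup.dist1 (GaugeField.plaqHol
              (Averaging.iter (fun i => BlockAveraging.blockAvg (P := F.P K) (j := i) T3UnitLawDensityEML.ℰp) j U) p))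
      = fun _ => ∫ X, GaugeGroup.dist1 (GaugeField.plaqHol
              (Averaging.iter (fun i => BlockAveraging.blockAvg (P := F.P K) (j := i) T3UnitLawDensityEML.ℰp) j X) p) ∂(T3UnitScaleTilt.gibbsK F T3UnitLawDensityEML.ℰp γ K) := by
    rw [h0]; exact condExp_bot _
  refine ⟨ℱ, 1, fun i _ => if i = 0 then Cv * (γ * ((F.L : ℝ)⁻¹) ^ (K - j)) else 0, h0, ?_, ?_, ?_, ?_, ?_⟩
  · -- `f` is `ℱ 1 = ⊤`-measurable
    rw [htop 1 le_rfl]; exact hf_meas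
  · -- adapted (constants)
    intro i
    by_cases hi : i = 0
    · simp only [hi, if_true]; exact stronglyMeasurable_const
    · simp only [hi, if_false]; exact stronglyMeasurable_const
  · -- non-negative
    intro i U
    by_cases hi : i = 0
    · simp only [hi, if_true]
      have hL0 : (0 : ℝ) < F.L := by exact_mod_cast lt_trans zero_lt_one F.hL.2
      positivity
    · simp only [hi, if_false]; exact le_rfl
  · -- the rows
    intro i s
    by_cases hi : i = 0
    · subst hi
      simp only [if_true]
      rw [hMtop 1 le_rfl, hM0, h0, condExp_bot]
      exact Filter.Eventually.of_forall fun U => hrow s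
    · have hi1 : 1 ≤ i := Nat.one_le_iff_ne_zero.mpr hi
      simp only [hi, if_false]
      rw [hMtop (i + 1) (by omega), hMtop i hi1]
      simp only [sub_self, mul_zero, Real.exp_zero, zero_div]
      have hc : MeasureTheory.condExp (ℱ i) (T3UnitScaleTilt.gibbsK F T3UnitLawDensityEML.ℰp γ K)
          (fun _ : GaugeField (F.P K) 0 (Matrix.specialUnitaryGroup (Fin 2) ℂ) => (1 : ℝ)) = fun _ => (1 : ℝ) := condExp_const (ℱ.le i) (1 : ℝ)
      rw [hc]
      exact Filter.Eventually.of_forall fun _ => le_rfl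
  · -- the proxy sum IS the budget
    refine Filter.Eventually.of_forall fun U _ => ?_
    simp only [Finset.sum_range_one, if_true]
    exact le_rfl

end Summit.QuantumFields.YangMills.Theorems.RevelationMartingaleProxyQV
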